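import Literature.MathematicalPhysics.QuantumFieldTheory.Balaban1983to89.B6Prop26OneScaleFromB5
import Literature.MathematicalPhysics.QuantumFieldTheory.Balaban1983to89.B5Hk163TorusHolderRate
import Literature.MathematicalPhysics.QuantumFieldTheory.Balaban1983to89.B5Hk163Form166

/-!
# `Balaban1983to89.B6MainResultsOneLevel` — [B6] **«This Corollary and Proposition 2.6 are our main technical results» (p. 249):
# the census Prop `B6.MainResults` = Prop. 2.6 ∧ Cor. 2.8 INHABITED ON ONE `B6.BlockData`, HYPOTHESIS-FREE, by the ONE-LEVEL torus
# family carrying BOTH functional families — `G = Δ_a⁻¹` ((2.19)/(2.22) = [4] (1.69)/(1.71)) and `H = GQ*(QGQ*)⁻¹` ((2.35) = [4]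
# (1.103) = `H_k`) — read on the SAME geometry («sites replaced by bonds», p. 248) in [4]'s (1.108)–(1.109) vocabulary**

FRAMING (verbatim cell line):
statement-level skeleton of published theorems with citation tags; proofs where landed; nothing here is a claim about the Yang–Mills mass gap

Sources (cell `lit-balaban`, HOME `run/shared/lean/pub/lit-balaban/`; seat **r03 gen 11** = the B6 fold owner, own lane under the
free-target protocol G.5-34(d); SKELETON row **B6.Main** (this file; `B6.MainResults` is the «main results» half of the row's decl
`B6.StatedBlock`), inputs B6.Prop2.6 (proved p303957 `B6Prop26OneScaleFromB5`, r03 g9), B6.Cor2.8 (proved p254241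
`B6Cor28OneScaleTorus`, p01 g5), B5.Prop1.2 (proved, r02/p37 `B5Prop12GHolds.prop12_famG_printed`), B5.Eq1.63 (the typed `H_k` of the
b05 lineage `B5Hk163Torus*`)): T. Bałaban, *Propagators and renormalization transformations for lattice gauge theories. II*, Commun. Math.
Phys. **96** (1984) 223–250 [`Balaban1984PropagatorsII`, "B6"].  PDF held: `paper:balaban1984-cmp96-propagators-rt-ii` (journal page =
PDF page + 222); pp. 248–249 [PDF 26–27] re-read on the text layer this session (`lit read … --pages 26-27`): p. 248 L7 *«We consider these
operators on the L²-space defined by (2.69) with sites replaced by bonds»*, p. 249 L15–21 *«Corollary 2.8. A kernel of the operator H,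
(HB)(b) = Σ_{c∈𝔅}(L^{j(c)}η)^d H(b, c)B(c), (2.150) satisfies the inequality … b ∈ Δ(y) or supp ζ ⊂ Δ(y), y ∈ Λ_j, c₋ ∈ Λ_{j′}.  This Corollary
and Proposition 2.6 are our main technical results. They will be used systematically in subsequent papers.»*; the verbatim statements of
Prop. 2.6 and Cor. 2.8 are the docstrings of `B6.Prop26Printed` / `B6.Cor28Printed` (certified against the ×2 renders by r03 g1).  [4] = T.
Bałaban, *… I*, Commun. Math. Phys. **95** (1984) 17–40 [`Balaban1984PropagatorsI`, "B5"]: (1.108)–(1.109) p. 35 (the norms `|J|`, `‖·‖_α`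
with `|x − x′| ≤ 1`, the cubes `Δ̃(y)`), Prop. 1.2 pp. 35–36, (1.63) p. 28, (1.103) p. 34, p. 29 lines 1–2 (Hölder continuity of `∂_νH_kB`).

## WHY THIS FILE (ROWS-B6 «Phase-2 targets», UPDATE gen 10 (b))

`B6.MainResults D := Prop26Printed D.geo D.G ∧ Cor28Printed D.d D.geo D.H` asks for BOTH main results on ONE `BlockData`, i.e. on one
index family of `B6.Geometry`s carrying the functionals of `G` (2.136)–(2.140) AND of `H` (2.150)–(2.151).  The tree had the two halves on
two different carriers: Prop. 2.6 on `B6Prop26OneScaleFromB5.geoFam/GFam` (sites = the POINTS of `T₁^{(K)}`, [4]'s vocabulary of r02's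
real weighted setting `B5SettingP12Real.latticeSettingP12R` = `B5Prop12GLattice.famG`), Cor. 2.8 on `B6Cor28OneScaleTorus.oneScaleBondGeo/
torusH` (sites = BONDS, dimension written `d + 1`, its own Hölder/cut-off vocabulary `holderS`/`fineDist`, all pairs).  This file puts
them on ONE geometry.

## WHAT THIS FILE PROVES (kernel-checked; 0 sorry; no new `def … : Prop`; every analytic input is a tree theorem USED BY NAME)

* §1 **«sites replaced by bonds»** (p. 248): the bond reading `bondGeo g B` of a `B6.Geometry` (sites `(y, μ)`, every field read through
  the base point) and of its `GFamily` (`bondG`); **`ineq2136_bond`**, **`prop26Printed_bond`**: (2.136)–(2.140) and `B6.Prop26Printed`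
  transfer VERBATIM (same witnesses) — the displays are statements about base points.
* §2 **the kernel of the typed `H_k` in [4]'s (1.108)–(1.109) vocabulary** (`Tor (fine n M)`, `cubeT` = `Δ̃(y)`, `cutInL`, `cutHL` =
  `‖ζ‖_α + |ζ|`, `distU`, `distSite`, `holderT`, `smulT` of r02's `B5Prop12FieldsLattice`), literal dimension `d + 1`, constants `CH0`, `CH1`,
  `rateH`, `CHα` (functions of the dimension, resp. of (dimension, α); OURS, crude, from the b05 lineage's `MG163`, `MD163`, `kappa163`,
  `periodConst`, `CHR`): `norm_HkOp_bpt_le` (`sup_{b∈Δ(y)}|H(b,c)| ≤ CH0·e^{−rateH|y−c₋|}`, b05's `B5Hk163Torus.norm_HkOp_le` by name),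
  `norm_dker_bpt_le'` (`|∂_νH|`, `B5Hk163TorusHolderDecay.norm_dker_bpt_le`), `norm_dker_le_of_mem_cubeT` / `norm_dker_sub_le_of_mem_cubeT`
  (sites of the DOUBLED cube `Δ̃(y)`: r02's `torusSupNorm_blockOf_sub_le_one` costs a factor `e^{rateH}`; the full-rate Hölder difference bound
  is b05's `B5Hk163TorusHolderRate.norm_dker_sub_le_rate`, the displacement read in `distU` through the centred representative `disp`),
  **`holderTerm_le`** (product rule + support of ζ, termwise) and **`holderT_smulT_DH_le`**: `‖ζ∇H(·,c)‖_α ≤ CHα·(‖ζ‖_α + |ζ|)·e^{−rateH|y−c₋|}`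
  for `supp ζ ⊂ Δ̃(y)`, `0 ≤ α < 1`, the seminorm being [4]'s (1.109) `holderT` (same tensor/vector index, pairs `|x − x′| ≤ 1`) — exactly the
  reading of famG's (1.111) functional `h1L = holderT (smulT ζ (∇GJ))`.
* §3 **the one-level block family** on the index of [4]'s tori of record (`B5ResidualGpTorusHolds.TopIdx d L`: every volume `2L^m`, every
  `K ≥ 1`; `η = L^{−K}`): `blockGeo d L a i := bondGeo (geoFam d L a i) (Fin d)` — sites = the unit BONDS of `T₁^{(K)} = Tor (MP P)`, distance =
  ℓ¹ circular distance of base points ((2.46) at one level, p. 223 «l¹-norm»), `M = R = 1`, (2.1)–(2.2) void, test functions / cut-offs /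
  norms = famG's; `blockG` = famG's (1.110)–(1.114) functionals of `G = Δ_a⁻¹` at the base point; `blockH` = the (2.150)–(2.151) functionals of
  `H_K = B5Hk163Torus.HkOp (nP P) (MP P)` in the same vocabulary.  **`prop26Printed_block`** (r03 g9's `prop26Printed_famG` through §1) and
  **`cor28Printed_block (hd : 1 ≤ d) : B6.Cor28Printed d (blockGeo d L a) (blockH d L a)`** — VERBATIM Corollary 2.8 with witnesses `M₁ = 1`,
  `δ₅ = rateH(d)/d`, `O(1) = max(CH0, CH1, 1)`, `C(α) = CHα(d, α)`, NO analytic hypothesis, uniformly in `K`, `m`, `a` (the dimension-generic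
  wrappers `…_gen` bridge famG's `Fin P.d` to the lineage's `Fin (d′+1)` by `P.d = d′ + 1` inside the proofs; no cast in any statement).
* §4 **`mainResults_oneLevel`**: `B6.MainResults (oneLevelBlock d L a δ₀ Gp Cinv Qinv J tree K loc)` for every `d ≥ 1`, odd `L > 1`, `a > 0`
  AND EVERY CHOICE of the carriers `MainResults` does not mention (`δ₀`, `Gp`, `Cinv`, `Qinv`, tree-gauge data, local operators are
  PARAMETERS of the bundle — no placeholder is chosen, nothing is claimed about them); `prop26_and_cor28_block` (the same without the
  bundle); non-vacuity `block_meets_hypotheses` (guards met by every member, `L^jη = 1`; the index is inhabited for `d ≥ 1`, odd `L > 1`: r03 g9's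
  `B6Prop26OneScaleFromB5.topIdx_nonempty`).  HONESTY LINKS:
  `blockG_e_eq` / `blockG_h1_e4_h2_l2_eq` (the `G`-functionals ARE [4]'s `eL`/`h1L`/`e4L`/`h2L`/`η^{d/2}l2locL` of `(DeltaA (nP P) (MP P) a)⁻¹`),
  **`blockH_operator_eq`**: the operator of `blockH` IS `(DeltaA …)⁻¹·Q*·(Q(DeltaA …)⁻¹Q*)⁻¹` — (2.35)/(1.103) built from THE SAME `G`
  (g12's `B5Hk163Form166.HkOp_eq_Hk` + `B5DeltaA169.calG_eq_DeltaA_inv`), `blockH_h_eq`.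

## HONEST SCOPE ∕ NOT CLAIMED

ONE LEVEL ONLY — exactly the scope of the two census heads it joins (B6.Prop2.6 `prop26Printed_famG` p303957, B6.Cor2.8
`cor28Printed_oneScaleTorus` p254241): Ω₁ = … = Ω_K = T_η, Λ_j = ∅ (j < K), all sites at scale K, every prefactor `(L^jη)^{…} = 1`, the
multi-scale distance (2.46) = the ℓ¹ unit-lattice distance; the genuinely multi-level statements (k ≥ 2 distinct levels, the glueings
(2.141)/(2.86), d(y, y′) across levels) remain the DAG hypotheses `B6.Prop26Printed`/`B6.Cor28Printed` downstream.  `B6.StatedBlock` (all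
eight statements, among them Lemma 2.1 with its refuted-as-printed constant c₁(α), cell G-A11-1 — the only one of the eight refuted as
printed; v1.1 ERRATUM: v1 wrongly added here «and Lemma 2.4 with its unproved printed constant» — the printed (2.128) constant 1/(12d²) IS
PROVED for every L on the concrete carriers, `…B6Lemma24Printed.lemma24_one`/`lemma24Printed_carrier`, torus
`…B6Lemma24Torus.lemma24Printed_torus`, cell G-B6-10U; G-B6-09 refutes only the printed intermediate (2.127)) is NOT claimed — only
`B6.MainResults`; inhabiting the parameter-form leaf `DagBinding.B6BlockParam` on ONE `BlockData` is open bookkeeping (Props. 2.2, 2.3, 2.7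
and Lemma 2.1 are proved on other one-scale geometries of record with different `Loc`/`Site` carriers).  Scalar model (U = 1), torus,
as the whole B5/B6 one-level lineage.  The route to Cor. 2.8 is [4]'s
((1.63) multipliers, analytic continuation — the «analyticity method»), NOT the composition Prop. 2.6 ∘ Prop. 2.7 ∘ Lemma 2.1 of the print
(that composition from printed-shape inputs is `…B6Cor28`).  Corollary 2.8's `supp ζ ⊂ Δ(y)` is read with [4]'s doubled cubes `Δ̃(y)` (a
formally STRONGER reading, as in `B6Prop26OneScaleFromB5`), its `‖·‖_α` as [4]'s (1.109) (pairs `|x − x′| ≤ 1`; p. 223 «we use all the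
notations introduced [in [4]]»); `b ∈ Δ(y)` = the fine bonds of the unit block of `y₋`.  Constants explicit but crude and OURS
(`CH0`, `CH1`, `CHα → ∞` as `α ↑ 1` like the print's C(α), `rateH`; dimension-only).  Value = the census Prop of the paper's «main
technical results» inhabited on ONE genuine family by [4]'s theorems and the b05 `H_k` lineage; NOT summit progress.

v1.1 (r03 gen 11, 2026-08-22): DOCSTRING-ONLY ERRATUM in «HONEST SCOPE» (the v1 sentence called Lemma 2.4's printed constant unproved —
wrong, see there); every declaration byte-identical to v1 (p312355, 95d9a3a69f63).
-/

namespace Literature.MathematicalPhysics.QuantumFieldTheory.Balaban1983to89.B6MainResultsOneLevel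

open Literature.MathematicalPhysics.QuantumFieldTheory.Balaban1983to89.B6 (Geometry GFamily HFamily BlockData Ineq2136_2140
  Prop26Printed Cor28Printed MainResults pref4 pref6)
open B6Prop26OneScaleFromB5 (geoOf gOf geoFam GFam dist1_le len_geoOf ineq2136_2140_famG)
open B5ResidualGpTorusHolds (TopIdx)
open B5SiteBridgeP12 (nP MP one_le_nP)
open B5Prop12GLattice (famG)
open B5Prop11Plancherel (Tor fine)
open B5Prop12FieldsLattice (distSite distU cdistF cubeT cutInL cutHL cutSupL holderT smulT distU_nonneg distU_self cutHL_nonneg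
  cutSupL_nonneg distSite_nonneg)
open B5Block118 (bpt)
open B6LowerBound2153Torus (toT rep toT_rep)
open B5Hk163Torus (HkOp norm_HkOp_le)
open B5Hk163TorusHolder (dker)
open B5Hk163TorusHolderDecay (MD163 norm_dker_bpt_le)
open B5Hk163TorusHolderRate (CHR CHR_nonneg norm_dker_sub_le_rate)
open B5Hk163Strip (kappa163 kappa163_pos)
open B5Hk163Decay (MG163)
open B4TorusKernel (periodConst)
open B4TorusKernel.MultiPeriod (torusSupNorm)
open B4ContourShift (supNorm supNorm_nonneg)
open B5Ineq110P12Lattice (distSite_eq_torusSupNorm torusSupNorm_blockOf_sub_le_one)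
open B5G115SupBound (exists_eq_bpt_blockOf)
open B5CoverP12Lattice (cdistF_le_mul_distU distU_comm)
open T4EtaRateOperatorTorus (torusSupNorm_add_le torusSupNorm_neg)
open LatticeNorms (holderSeminorm holderSeminormB5 holderSeminorm_le holder_bound holderSeminorm_nonneg norm_le_supNorm
  supNorm_nonneg)

noncomputable section

/-! ## §1  «sites replaced by bonds» (p. 248): the bond reading of a geometry and of its `G`-functionals -/

section Bond

variable (g : Geometry) (B : Type) [Fintype B]

/-- **«sites replaced by bonds»** (p. 248: *«We consider these operators on the L²-space defined by (2.69) with sites replaced by bonds»*;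
(2.150): the kernel `H(b, c)` is indexed by bonds): the reading of a geometry `g` whose sites are the pairs `(y, μ)` (a bond = base point +
direction index in `B`), every field of `g` — scale, distance (2.46), test functions, supports `supp ⊂ Δ(y′)`, norms, cut-offs — read
through the base point. [cite: Balaban1984PropagatorsII, p.248 + (2.150) p.249, (2.46) p.231] -/
def bondGeo : Geometry where
  Site := g.Site × B
  fin := inferInstance
  scale := fun y => g.scale y.1
  dist := fun y c => g.dist y.1 c.1
  k := g.k
  eta := g.eta
  L := g.L
  R := g.R
  M := g.M
  Hyp21_22 := g.Hyp21_22
  Loc := g.Loc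
  suppIn := fun J c => g.suppIn J c.1
  supNorm := g.supNorm
  l2Norm := g.l2Norm
  holder := g.holder
  Cut := g.Cut
  cutIn := fun ζ y => g.cutIn ζ y.1
  cutH := g.cutH
  cutSup := g.cutSup

variable {g B}

/-- the (2.136)–(2.140) functionals of an operator on `g`, read on the bond geometry (`x ∈ Δ(y)`, `supp J ⊂ Δ(y′)` through the base
points). [cite: Balaban1984PropagatorsII, (2.136)–(2.140) p.247] -/
def bondG (G : GFamily g) : GFamily (bondGeo g B) where
  e := fun n J y => G.e n J y.1
  h1 := G.h1
  e4 := fun J y => G.e4 J y.1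
  h2 := G.h2
  l2 := G.l2

/-- `L^jη` of a bond is that of its base point. [cite: Balaban1984PropagatorsII, (2.1) p.224] -/
theorem bondGeo_len (y : (bondGeo g B).Site) : (bondGeo g B).len y = g.len y.1 := rfl

/-- **(2.136)–(2.140) transfer verbatim to the bond reading** (same constants, same rate): each display is a statement about the base
points. [cite: Balaban1984PropagatorsII, Prop. 2.6 (2.136)–(2.140) p.247] -/
theorem ineq2136_bond {G : GFamily g} {C : ℝ} {Cα Cε : ℝ → ℝ} {Cαε : ℝ → ℝ → ℝ} {δ : ℝ}
    (h : Ineq2136_2140 G C Cα Cε Cαε δ) : Ineq2136_2140 (bondG (B := B) G) C Cα Cε Cαε δ := by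
  obtain ⟨h1, h2, h3, h4, h5⟩ := h
  exact ⟨fun n J y y' hJ => h1 n J y.1 y'.1 hJ,
    fun α J ζ y y' hα0 hα1 hζ hJ => h2 α J ζ y.1 y'.1 hα0 hα1 hζ hJ,
    fun ε J y y' hε0 hε1 hJ => h3 ε J y.1 y'.1 hε0 hε1 hJ,
    fun α ε J ζ y y' hα hε hαε hζ hJ => h4 α ε J ζ y.1 y'.1 hα hε hαε hζ hJ,
    fun n J h y y' hh hJ => h5 n J h y.1 y'.1 hh hJ⟩

/-- **Proposition 2.6 transfers verbatim to the bond reading of a family** (same witnesses `M₁, δ₃, O(1), C(α), C(ε), C(α,ε)`).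
[cite: Balaban1984PropagatorsII, Prop. 2.6 (2.136)–(2.141) p.247] -/
theorem prop26Printed_bond {I : Type} {geo : I → Geometry} {G : ∀ i, GFamily (geo i)} (Bf : I → Type)
    [∀ i, Fintype (Bf i)] (h : Prop26Printed geo G) :
    Prop26Printed (fun i => bondGeo (geo i) (Bf i)) (fun i => bondG (B := Bf i) (G i)) := by
  obtain ⟨M₁, δ₃, C, Cα, Cε, Cαε, hM₁, hδ₃, hC, hall⟩ := h
  exact ⟨M₁, δ₃, C, Cα, Cε, Cαε, hM₁, hδ₃, hC, fun i hH hM => ineq2136_bond (hall i hH hM)⟩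

end Bond

/-! ## §2  The kernel of the typed `H_k` in [4]'s (1.108)–(1.109) vocabulary (literal dimension `d + 1`) -/

section Consts

/-- the sup constant of `|H(b,c)|` in dimension `D`: `MG163(D)·periodConst(κ₁₆₃(D), D−1)` (b05 lineage constants,
ours). [cite: Balaban1984PropagatorsII, Cor. 2.8 (2.151) p.249 (the O(1) of the first entry; value ours)] -/
def CH0 (D : ℕ) : ℝ := MG163 D * periodConst (kappa163 D) (D - 1)

/-- the sup constant of `|(∇H)(b,c)|` in dimension `D` (ours). [cite: Balaban1984PropagatorsII, Cor. 2.8 (2.151) p.249 (the O(1) of the second entry; value ours)] -/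
def CH1 (D : ℕ) : ℝ := MD163 D * periodConst (kappa163 D) (D - 1)

/-- the decay rate of the typed `H_k` in the unit-lattice sup-distance, dimension `D`: `κ₁₆₃(D)/D` (ours; `δ₅ = rateH/D` below).
[cite: Balaban1984PropagatorsII, Cor. 2.8 (2.151) p.249 (δ₅; value ours)] -/
def rateH (D : ℕ) : ℝ := kappa163 D / D

/-- the Hölder constant in dimension `D`: `e^{rateH D}·max(CH1 D, CHR(D−1, α))` (ours; `→ ∞` as `α ↑ 1` like the print's C(α)).
[cite: Balaban1984PropagatorsII, Cor. 2.8 (2.151) p.249 (the O(1) = C(α) of the third entry; value ours)] -/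
def CHα (D : ℕ) (α : ℝ) : ℝ := Real.exp (rateH D) * max (CH1 D) (CHR (D - 1) α)

/-- `rateH (d+1) = κ₁₆₃(d+1)/(d+1)`. [folklore] -/
private theorem rateH_succ (d : ℕ) : rateH (d + 1) = kappa163 (d + 1) / ((d : ℝ) + 1) := by
  simp [rateH, Nat.cast_succ]

/-- `CH0 (d+1)` in the lineage's form. [folklore] -/
private theorem CH0_succ (d : ℕ) : CH0 (d + 1) = MG163 (d + 1) * periodConst (kappa163 (d + 1)) d := by
  simp [CH0]

/-- `CH1 (d+1)` in the lineage's form. [folklore] -/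
private theorem CH1_succ (d : ℕ) : CH1 (d + 1) = MD163 (d + 1) * periodConst (kappa163 (d + 1)) d := by
  simp [CH1]

/-- `CHα (d+1) α` in the lineage's form. [folklore] -/
private theorem CHα_succ (d : ℕ) (α : ℝ) :
    CHα (d + 1) α = Real.exp (rateH (d + 1)) * max (CH1 (d + 1)) (CHR d α) := by
  simp [CHα]

/-- `0 < rateH D` for `D ≥ 1`. [folklore] -/
private theorem rateH_pos {D : ℕ} (hD : 1 ≤ D) : 0 < rateH D :=
  div_pos (kappa163_pos D) (by exact_mod_cast hD)

/-- `0 ≤ CHα`. [folklore] -/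
private theorem CHα_nonneg (D : ℕ) (α : ℝ) : 0 ≤ CHα D α :=
  mul_nonneg (Real.exp_pos _).le (le_max_of_le_right (CHR_nonneg α))

end Consts

section Hk

variable {d : ℕ} (n : ℕ) [NeZero n] (M : Fin (d + 1) → ℕ) [hM : ∀ μ, NeZero (M μ)]

/-- the decay factor `e^{−rateH·|y − c|}` on the unit torus (`|y − c|` = [4]'s sup circular distance `distSite`).
[cite: Balaban1984PropagatorsII, Cor. 2.8 (2.151) p.249 (the factor e^{−δ₅d(y,c₋)}); Balaban1984PropagatorsI, (1.110) p.35 (|y − y′|)] -/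
def EH (y c : Tor M) : ℝ := Real.exp (-(rateH (d + 1) * distSite M y c))

omit [NeZero n] hM in
/-- `0 < EH`. [folklore] -/
private theorem EH_pos (y c : Tor M) : 0 < EH M y c := Real.exp_pos _

/-- **first entry of (2.151)**, `sup_{b ∈ Δ(y)} |H(b, c)|`: `‖H_k((n·y + r, μ), (c, λ))‖ ≤ CH0·e^{−rateH·|y−c|}` uniformly in `n` and in the
torus (b05's `norm_HkOp_le` BY NAME, in [4]'s distance). [cite: Balaban1984PropagatorsII, Cor. 2.8 (2.151) p.249 (first entry)] -/
theorem norm_HkOp_bpt_le (y c : Tor M) (r : Fin (d + 1) → Fin n) (μ lam : Fin (d + 1)) :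
    ‖HkOp n M (bpt n M y r, μ) (c, lam)‖ ≤ CH0 (d + 1) * EH M y c := by
  have h := norm_HkOp_le n M μ lam r (rep M y) (rep M c)
  rw [toT_rep, toT_rep, ← distSite_eq_torusSupNorm] at h
  rw [CH0_succ, EH, rateH_succ]
  exact h

/-- **second entry of (2.151)**: `‖∂_νH_k((n·y + r, μ), (c, λ))‖ ≤ CH1·e^{−rateH·|y−c|}` with `∂_ν = η⁻¹ ×` forward difference, UNIFORMLY
in `η = 1/n` (b05's `norm_dker_bpt_le` BY NAME). [cite: Balaban1984PropagatorsII, Cor. 2.8 (2.151) p.249 (second entry)] -/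
theorem norm_dker_bpt_le' (y c : Tor M) (r : Fin (d + 1) → Fin n) (μ lam ν : Fin (d + 1)) :
    ‖dker n M μ lam ν (bpt n M y r) c‖ ≤ CH1 (d + 1) * EH M y c := by
  have h := norm_dker_bpt_le n M μ lam ν r (rep M y) (rep M c)
  rw [toT_rep, toT_rep, ← distSite_eq_torusSupNorm] at h
  rw [CH1_succ, EH, rateH_succ]
  exact h

/-- a site of the doubled cube `Δ̃(y)` has its block within unit distance of `y`: `|y − c| ≤ 1 + |blockOf x − c|`
(r02's `torusSupNorm_blockOf_sub_le_one` + triangle inequality). [cite: Balaban1984PropagatorsI, p.35 («Δ̃(y) … sums of 2^d unit cubes having the point y as a corner»)] -/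
theorem distSite_le_one_add (hn : 1 ≤ n) {x : Tor (fine n M)} {y : Tor M} (hx : x ∈ cubeT n M y) (c : Tor M) :
    distSite M y c ≤ 1 + distSite M (B5Blocks16.blockOf n M x) c := by
  rw [distSite_eq_torusSupNorm, distSite_eq_torusSupNorm]
  have h1 := torusSupNorm_blockOf_sub_le_one M hn hx
  have h2 := torusSupNorm_add_le M (rep M y - rep M (B5Blocks16.blockOf n M x)) (rep M (B5Blocks16.blockOf n M x) - rep M c)
  rw [sub_add_sub_cancel] at h2
  rw [← neg_sub, torusSupNorm_neg] at h1
  linarith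

/-- hence `e^{−rateH·|blockOf x − c|} ≤ e^{rateH}·e^{−rateH·|y − c|}` for `x ∈ Δ̃(y)`. [folklore] -/
private theorem EH_blockOf_le (hn : 1 ≤ n) {x : Tor (fine n M)} {y : Tor M} (hx : x ∈ cubeT n M y) (c : Tor M) :
    EH M (B5Blocks16.blockOf n M x) c ≤ Real.exp (rateH (d + 1)) * EH M y c := by
  rw [EH, EH, ← Real.exp_add]
  apply Real.exp_le_exp.mpr
  have hr : 0 ≤ rateH (d + 1) := (rateH_pos (Nat.succ_pos d)).le
  have h := distSite_le_one_add n M hn hx c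
  nlinarith

/-- `‖∂_νH_k((x, μ), c)‖ ≤ CH1·e^{rateH}·e^{−rateH|y − c₋|}` for every fine site `x` of the doubled cube `Δ̃(y)`.
[cite: Balaban1984PropagatorsII, Cor. 2.8 (2.151) p.249 (second entry, supp ζ ⊂ Δ(y) read as [4]'s Δ̃(y))] -/
theorem norm_dker_le_of_mem_cubeT (hn : 1 ≤ n) {x : Tor (fine n M)} {y : Tor M} (hx : x ∈ cubeT n M y)
    (c : Tor M) (μ lam ν : Fin (d + 1)) :
    ‖dker n M μ lam ν x c‖ ≤ CH1 (d + 1) * (Real.exp (rateH (d + 1)) * EH M y c) := by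
  obtain ⟨r, hr⟩ := exists_eq_bpt_blockOf n M x
  have h := norm_dker_bpt_le' n M (B5Blocks16.blockOf n M x) c r μ lam ν
  rw [← hr] at h
  have hC : 0 ≤ CH1 (d + 1) := by
    have h0 : 0 * EH M (B5Blocks16.blockOf n M x) c ≤ CH1 (d + 1) * EH M (B5Blocks16.blockOf n M x) c := by
      rw [zero_mul]; exact (norm_nonneg _).trans h
    exact le_of_mul_le_mul_right h0 (EH_pos M _ c)
  exact h.trans (mul_le_mul_of_nonneg_left (EH_blockOf_le n M hn hx c) hC)

/-- the centred integer displacement of two fine sites: `z_μ = valMinAbs (x′_μ − x_μ)` (so `x′ = x + z` on the torus and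
`|z|_∞ = n·|x − x′|`). [folklore] -/
def disp (x x' : Tor (fine n M)) : Fin (d + 1) → ℤ := fun μ => (x' μ - x μ).valMinAbs

omit [NeZero n] hM in
/-- `x + z = x′` on the fine torus. [folklore] -/
private theorem toT_disp (x x' : Tor (fine n M)) : x + toT (fine n M) (disp n M x x') = x' := by
  funext μ
  simp [toT, disp, ZMod.coe_valMinAbs]

omit hM in
/-- `|z|_∞ ≤ n·|x − x′|` (in fact equality): the sup norm of the centred displacement is the fine sup-distance of [4] (1.109)
(`distU`, in units). [cite: Balaban1984PropagatorsI, (1.109) p.35 (|x − x′|)] -/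
theorem supNorm_disp_le (x x' : Tor (fine n M)) : supNorm (disp n M x x') ≤ n * distU n M x x' := by
  unfold supNorm
  refine Finset.sup'_le _ _ fun μ _ => ?_
  have h1 : ((|disp n M x x' μ| : ℤ) : ℝ) = ((cdistF n M x' x μ : ℕ) : ℝ) := by
    have : (|disp n M x x' μ| : ℤ) = ((cdistF n M x' x μ : ℕ) : ℤ) := by
      simp only [disp, cdistF, Int.natCast_natAbs]
    exact_mod_cast this
  rw [h1, distU_comm]
  exact cdistF_le_mul_distU M n x' x μ

/-- the full-rate Hölder bound of the typed `∂_νH_k` for two sites of `Δ̃(y)`: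
`‖∂_νH((x′,μ),c) − ∂_νH((x,μ),c)‖ ≤ CHR·|x − x′|^α·e^{rateH}·e^{−rateH|y − c₋|}`, `0 ≤ α < 1`, uniformly in `η` (b05's
`norm_dker_sub_le_rate` BY NAME, the displacement read in [4]'s `distU`). [cite: Balaban1984PropagatorsII, Cor. 2.8 (2.151) p.249 (third entry); Balaban1984PropagatorsI, p.29 («bounds on (1/|x′−x|^α)|∂_ν(H_kB)_μ(x′) − ∂_ν(H_kB)_μ(x)|»)] -/
theorem norm_dker_sub_le_of_mem_cubeT (hn : 1 ≤ n) {x x' : Tor (fine n M)} {y : Tor M} (hx : x ∈ cubeT n M y)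
    (hx' : x' ∈ cubeT n M y) (c : Tor M) (μ lam ν : Fin (d + 1)) {α : ℝ} (hα0 : 0 ≤ α) (hα1 : α < 1) :
    ‖dker n M μ lam ν x' c - dker n M μ lam ν x c‖ ≤
      CHR d α * distU n M x x' ^ α * (Real.exp (rateH (d + 1)) * EH M y c) := by
  obtain ⟨r, hr⟩ := exists_eq_bpt_blockOf n M x
  obtain ⟨r', hr'⟩ := exists_eq_bpt_blockOf n M x'
  set yb := B5Blocks16.blockOf n M x with hyb
  set yb' := B5Blocks16.blockOf n M x' with hyb'
  have hz : bpt n M (toT M (rep M yb')) r' = bpt n M (toT M (rep M yb)) r + toT (fine n M) (disp n M x x') := by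
    rw [toT_rep, toT_rep, ← hr, ← hr', toT_disp]
  have h : ‖dker n M μ lam ν x' c - dker n M μ lam ν x c‖ ≤
      CHR d α * (supNorm (disp n M x x') / n) ^ α * max (EH M yb' c) (EH M yb c) := by
    have h := norm_dker_sub_le_rate n M μ lam ν (rep M yb) (rep M yb') (rep M c) r r' (disp n M x x') hz hα0 hα1
    rw [toT_rep, toT_rep, toT_rep, ← hr, ← hr', ← distSite_eq_torusSupNorm, ← distSite_eq_torusSupNorm,
      ← rateH_succ] at h
    exact h
  have hn0 : (0 : ℝ) < n := by exact_mod_cast hn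
  have hρ : (supNorm (disp n M x x') / n) ^ α ≤ distU n M x x' ^ α := by
    refine Real.rpow_le_rpow (div_nonneg (supNorm_nonneg _) hn0.le) ?_ hα0
    rw [div_le_iff₀ hn0, mul_comm]
    exact supNorm_disp_le n M x x'
  have hE : max (EH M yb' c) (EH M yb c) ≤ Real.exp (rateH (d + 1)) * EH M y c :=
    max_le (EH_blockOf_le n M hn hx' c) (EH_blockOf_le n M hn hx c)
  have hm0 : 0 ≤ max (EH M yb' c) (EH M yb c) := le_max_of_le_left (EH_pos M _ _).le
  calc _ ≤ _ := h
    _ ≤ CHR d α * distU n M x x' ^ α * max (EH M yb' c) (EH M yb c) :=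
        mul_le_mul_of_nonneg_right (mul_le_mul_of_nonneg_left hρ (CHR_nonneg α)) hm0
    _ ≤ _ := mul_le_mul_of_nonneg_left hE (mul_nonneg (CHR_nonneg α) (Real.rpow_nonneg (distU_nonneg _ _) _))

/-- **the cut-off Hölder entry, termwise**: for `supp ζ ⊂ Δ̃(y)` (`cutInL`), `0 ≤ α < 1`, and an admissible pair of [4]'s
(1.109) (`|x − x′| ≤ 1`, `x ≠ x′`): `‖ζ(x′)∂_νH((x′,μ),c) − ζ(x)∂_νH((x,μ),c)‖ ≤ CHα·(‖ζ‖_α + |ζ|)·e^{−rateH|y−c₋|}·|x − x′|^α`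
— product rule, the support of `ζ`, the sup bound and the full-rate Hölder bound of the typed `∂_νH_k`.
[cite: Balaban1984PropagatorsII, Cor. 2.8 (2.151) p.249 (third entry ‖(ζ∇H)(·,c)‖_α); Balaban1984PropagatorsI, (1.109) p.35] -/
theorem holderTerm_le (hn : 1 ≤ n) {y : Tor M} {ζ : Tor (fine n M) → ℝ} (hζ : cutInL n M ζ y)
    (c : Tor M × Fin (d + 1)) {α : ℝ} (hα0 : 0 ≤ α) (hα1 : α < 1) {x x' : Tor (fine n M)}
    (hd1 : distU n M x x' ≤ 1) (hpos : 0 < distU n M x x') (μ ν : Fin (d + 1)) :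
    ‖(ζ x' : ℂ) * dker n M μ c.2 ν x' c.1 - (ζ x : ℂ) * dker n M μ c.2 ν x c.1‖ ≤
      CHα (d + 1) α * cutHL n M α ζ * EH M y c.1 * distU n M x x' ^ α := by
  set A1 : ℝ := CH1 (d + 1)
  set K : ℝ := max A1 (CHR d α) with hK
  set E : ℝ := Real.exp (rateH (d + 1)) * EH M y c.1 with hE
  set HS : ℝ := holderSeminorm α (fun b b' : Tor (fine n M) => True ∧ distU n M b b' ≤ 1) (distU n M)
    (fun _ _ => id) Finset.univ ζ with hHS
  set ρ : ℝ := distU n M x x'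
  have hcut : cutHL n M α ζ = HS + cutSupL n M ζ := rfl
  have hCH : CHα (d + 1) α * cutHL n M α ζ * EH M y c.1 * ρ ^ α = K * (HS + cutSupL n M ζ) * E * ρ ^ α := by
    rw [CHα_succ, hcut]; ring
  rw [hCH]
  have hEpos : 0 < E := mul_pos (Real.exp_pos _) (EH_pos M y c.1)
  have hK0 : 0 ≤ K := le_max_of_le_right (CHR_nonneg α)
  have hHS : 0 ≤ HS := holderSeminorm_nonneg _ _ _ _ _ _
  have hsup0 : 0 ≤ cutSupL n M ζ := cutSupL_nonneg ζ
  have hρα : 0 < ρ ^ α := Real.rpow_pos_of_pos hpos α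
  have hζdiff : |ζ x' - ζ x| ≤ HS * ρ ^ α := by
    have h := holder_bound (α := α) (adm := fun b b' : Tor (fine n M) => True ∧ distU n M b b' ≤ 1)
      (dist := distU n M) (τ := fun _ _ => id) (S := Finset.univ) ζ (Finset.mem_univ x) (Finset.mem_univ x')
      ⟨trivial, hd1⟩ hpos
    rw [Real.norm_eq_abs] at h
    exact h
  have hζsup : ∀ t, |ζ t| ≤ cutSupL n M ζ := fun t => by
    have h := norm_le_supNorm ζ (Finset.mem_univ t)
    rwa [Real.norm_eq_abs] at h
  have hD : ∀ t, t ∈ cubeT n M y → ‖dker n M μ c.2 ν t c.1‖ ≤ A1 * E := fun t ht =>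
    norm_dker_le_of_mem_cubeT n M hn ht c.1 μ c.2 ν
  have hnn2 : 0 ≤ cutSupL n M ζ * (CHR d α * ρ ^ α * E) :=
    mul_nonneg hsup0 (mul_nonneg (mul_nonneg (CHR_nonneg α) hρα.le) hEpos.le)
  -- both cut-off values zero: nothing to prove
  by_cases h12 : ζ x = 0 ∧ ζ x' = 0
  · rw [h12.1, h12.2, Complex.ofReal_zero, zero_mul, zero_mul, sub_self, norm_zero]
    exact mul_nonneg (mul_nonneg (mul_nonneg hK0 (add_nonneg hHS hsup0)) hEpos.le) hρα.le
  -- the common final step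
  have hfin : HS * ρ ^ α * (A1 * E) + cutSupL n M ζ * (CHR d α * ρ ^ α * E) ≤
      K * (HS + cutSupL n M ζ) * E * ρ ^ α := by
    have h1 : HS * ρ ^ α * (A1 * E) ≤ HS * ρ ^ α * (K * E) :=
      mul_le_mul_of_nonneg_left (mul_le_mul_of_nonneg_right (le_max_left _ _) hEpos.le) (mul_nonneg hHS hρα.le)
    have h2 : cutSupL n M ζ * (CHR d α * ρ ^ α * E) ≤ cutSupL n M ζ * (K * ρ ^ α * E) :=
      mul_le_mul_of_nonneg_left
        (mul_le_mul_of_nonneg_right (mul_le_mul_of_nonneg_right (le_max_right _ _) hρα.le) hEpos.le) hsup0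
    calc _ ≤ HS * ρ ^ α * (K * E) + cutSupL n M ζ * (K * ρ ^ α * E) := add_le_add h1 h2
      _ = K * (HS + cutSupL n M ζ) * E * ρ ^ α := by ring
  refine le_trans ?_ hfin
  by_cases h2 : ζ x' = 0
  · -- only x carries ζ, so x ∈ Δ̃(y) and the term is (ζ x′ − ζ x)·∂H(x)
    have h1 : ζ x ≠ 0 := fun h1 => h12 ⟨h1, h2⟩
    have hD1 := hD x (hζ x h1)
    rw [h2, Complex.ofReal_zero, zero_mul, zero_sub, norm_neg, norm_mul, Complex.norm_real, Real.norm_eq_abs]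
    have hz : |ζ x| = |ζ x' - ζ x| := by rw [h2, zero_sub, abs_neg]
    rw [hz]
    exact le_add_of_le_of_nonneg (mul_le_mul hζdiff hD1 (norm_nonneg _) (mul_nonneg hHS hρα.le)) hnn2
  · by_cases h1 : ζ x = 0
    · -- only x′ carries ζ
      have hD2 := hD x' (hζ x' h2)
      rw [h1, Complex.ofReal_zero, zero_mul, sub_zero, norm_mul, Complex.norm_real, Real.norm_eq_abs]
      have hz : |ζ x'| = |ζ x' - ζ x| := by rw [h1, sub_zero]
      rw [hz]
      exact le_add_of_le_of_nonneg (mul_le_mul hζdiff hD2 (norm_nonneg _) (mul_nonneg hHS hρα.le)) hnn2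
    · -- both points lie in Δ̃(y): product rule
      have hb1 := hζ x h1
      have hb2 := hζ x' h2
      have hD1 := hD x hb1
      have hD21 : ‖dker n M μ c.2 ν x' c.1 - dker n M μ c.2 ν x c.1‖ ≤ CHR d α * ρ ^ α * E :=
        norm_dker_sub_le_of_mem_cubeT n M hn hb1 hb2 c.1 μ c.2 ν hα0 hα1
      set D₁ := dker n M μ c.2 ν x c.1
      set D₂ := dker n M μ c.2 ν x' c.1
      have hsplit : (ζ x' : ℂ) * D₂ - (ζ x : ℂ) * D₁ = (ζ x' : ℂ) * (D₂ - D₁) + ((ζ x' : ℂ) - (ζ x : ℂ)) * D₁ := by ring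
      rw [hsplit]
      calc ‖(ζ x' : ℂ) * (D₂ - D₁) + ((ζ x' : ℂ) - (ζ x : ℂ)) * D₁‖
          ≤ ‖(ζ x' : ℂ) * (D₂ - D₁)‖ + ‖((ζ x' : ℂ) - (ζ x : ℂ)) * D₁‖ := norm_add_le _ _
        _ = |ζ x'| * ‖D₂ - D₁‖ + |ζ x' - ζ x| * ‖D₁‖ := by
            rw [norm_mul, norm_mul, Complex.norm_real, Real.norm_eq_abs, ← Complex.ofReal_sub, Complex.norm_real,
              Real.norm_eq_abs]
        _ ≤ cutSupL n M ζ * (CHR d α * ρ ^ α * E) + HS * ρ ^ α * (A1 * E) :=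
            add_le_add (mul_le_mul (hζsup x') hD21 (norm_nonneg _) hsup0)
              (mul_le_mul hζdiff hD1 (norm_nonneg _) (mul_nonneg hHS hρα.le))
        _ = HS * ρ ^ α * (A1 * E) + cutSupL n M ζ * (CHR d α * ρ ^ α * E) := add_comm _ _

end Hk

section DH

variable {d : ℕ} (n : ℕ) [NeZero n] (M : Fin d → ℕ) [∀ μ, NeZero (M μ)]

/-- `(∇H)(·, c)` as a `d`-tensor bond field: `ν ↦ ((x, μ) ↦ ∂_νH_k((x, μ), c))` (the argument of the Hölder norm in (2.151)).
[cite: Balaban1984PropagatorsII, Cor. 2.8 (2.151) p.249 (‖(ζ∇H)(·,c)‖_α)] -/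
def DH (c : Tor M × Fin d) : Fin d → (Tor (fine n M) × Fin d → ℂ) := fun ν b => dker n M b.2 c.2 ν b.1 c.1

end DH

section HkHolder

variable {d : ℕ} (n : ℕ) [NeZero n] (M : Fin (d + 1) → ℕ) [hM : ∀ μ, NeZero (M μ)]

/-- **Entry `‖(ζ∇H)(·, c)‖_α` in [4]'s (1.109) convention**: for `supp ζ ⊂ Δ̃(y)` and `0 ≤ α < 1`,
`‖ζ∇H(·, c)‖_α ≤ CHα(d+1, α)·(‖ζ‖_α + |ζ|)·e^{−rateH|y − c₋|}`, uniformly in `n` and in the torus — the Hölder seminorm being [4]'s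
`holderT` (same tensor and vector index, pairs `|x − x′| ≤ 1`, distance `distU`), exactly as in famG's (1.111) functional `h1L`.
[cite: Balaban1984PropagatorsII, Cor. 2.8 (2.151) p.249 (third entry); Balaban1984PropagatorsI, (1.109) p.35, (1.111) p.35] -/
theorem holderT_smulT_DH_le (hn : 1 ≤ n) {y : Tor M} {ζ : Tor (fine n M) → ℝ} (hζ : cutInL n M ζ y)
    (c : Tor M × Fin (d + 1)) {α : ℝ} (hα0 : 0 ≤ α) (hα1 : α < 1) :
    holderT n M α (smulT n M ζ (DH n M c)) ≤ CHα (d + 1) α * cutHL n M α ζ * EH M y c.1 := by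
  have hC : 0 ≤ CHα (d + 1) α * cutHL n M α ζ * EH M y c.1 := by
    refine mul_nonneg (mul_nonneg ?_ (cutHL_nonneg α ζ)) (EH_pos M y c.1).le
    rw [CHα_succ]
    exact mul_nonneg (Real.exp_pos _).le (le_max_of_le_right (CHR_nonneg α))
  unfold holderT holderSeminormB5
  refine holderSeminorm_le hC fun p _ p' _ hadm hpos => ?_
  obtain ⟨ν, x, μ⟩ := p
  obtain ⟨ν', x', μ'⟩ := p'
  obtain ⟨⟨hν, hμ⟩, hd1⟩ := hadm
  dsimp only at hν hμ hd1 hpos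
  subst hν hμ
  show ‖(ζ x' : ℂ) * dker n M μ c.2 ν x' c.1 - (ζ x : ℂ) * dker n M μ c.2 ν x c.1‖ ≤ _
  exact holderTerm_le n M hn hζ c hα0 hα1 hd1 hpos μ ν

end HkHolder


/-! ## §3  The one-level block family: ONE geometry carrying both `G` and `H` -/

section Family

variable (d L : ℕ) (a : ℝ)

/-- **the one-level block geometry of member `i`** = the bond reading (§1) of r03 g9's one-level geometry `geoFam d L a i` of
[4]'s torus of record: sites = the unit BONDS `(y, μ)` of `T₁^{(K)} = Tor (MP P)`, all at scale `K`, `η = L^{−K}`, distance =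
the ℓ¹ circular distance of the base points ((2.46) at one level), `M = R = 1`, (2.1)–(2.2) void; test functions, cut-offs and
norms = [4]'s (1.108)–(1.109) (`LocR`, `suppInL`, `supNormL`, `holderL`, `cutInL` = supp ζ ⊂ Δ̃(y), `cutHL` = ‖ζ‖_α + |ζ|, `cutSupL`).
[cite: Balaban1984PropagatorsII, (2.1)–(2.4) p.224, (2.46) p.231, p.248 («sites replaced by bonds»); Balaban1984PropagatorsI, (1.108)–(1.109) p.35] -/
def blockGeo (i : TopIdx d L) : Geometry := bondGeo (geoFam d L a i) (Fin i.P.d)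

/-- **the (2.136)–(2.140) functionals of `G = Δ_a⁻¹` on member `i`** = [4]'s (1.110)–(1.114) functionals (`GFam`) read at the base
point of the bond. [cite: Balaban1984PropagatorsII, Prop. 2.6 (2.136)–(2.140) p.247; Balaban1984PropagatorsI, Prop. 1.2 (1.110)–(1.114) pp.35–36] -/
def blockG (i : TopIdx d L) : GFamily (blockGeo d L a i) := bondG (B := Fin i.P.d) (GFam d L a i)

/-- **the (2.150)–(2.151) functionals of `H = GQ*(QGQ*)⁻¹ = H_K` on member `i`** (`B5Hk163Torus.HkOp (nP P) (MP P)`):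
`e 0 y c = sup_{b ∈ Δ(y)} ‖H(b, c)‖` over the fine bonds `b = (L^K·y₋ + r, μ)` of the block of `y₋`, `e 1 y c = sup_{b ∈ Δ(y), ν}
‖∂_νH(b, c)‖` (`B5Hk163TorusHolder.dker`), `h α ζ c = ‖ζ∇H(·, c)‖_α` = [4]'s (1.109) Hölder seminorm (`holderT`) of the cut tensor
field `ζ·(∇H)(·, c)` (`smulT`, `DH`) — the same reading as famG's (1.111) functional `h1L` of `G`.
[cite: Balaban1984PropagatorsII, Cor. 2.8 (2.150)–(2.151) p.249, (2.35) p.228; Balaban1984PropagatorsI, (1.63) p.28, (1.103) p.34, (1.109) p.35] -/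
def blockH (i : TopIdx d L) : HFamily (blockGeo d L a i) where
  e := fun m y c =>
    if m = 0 then
      ⨆ p : (Fin i.P.d → Fin (nP i.P)) × Fin i.P.d, ‖HkOp (nP i.P) (MP i.P) (bpt (nP i.P) (MP i.P) y.1 p.1, p.2) c‖
    else
      ⨆ p : (Fin i.P.d → Fin (nP i.P)) × Fin i.P.d × Fin i.P.d,
        ‖dker (nP i.P) (MP i.P) p.2.1 c.2 p.2.2 (bpt (nP i.P) (MP i.P) y.1 p.1) c.1‖
  h := fun α ζ c => holderT (nP i.P) (MP i.P) α (smulT (nP i.P) (MP i.P) ζ (DH (nP i.P) (MP i.P) c))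

variable {d L a}

/-- the fields of the block geometry ARE [4]'s: `cutIn ζ y ↔ supp ζ ⊂ Δ̃(y₋)`. [cite: Balaban1984PropagatorsI, Prop. 1.2 (1.111) p.35 (ζ ∈ C₀^∞(Δ̃(y)))] -/
theorem blockGeo_cutIn (i : TopIdx d L) (ζ : (blockGeo d L a i).Cut) (y : (blockGeo d L a i).Site) :
    (blockGeo d L a i).cutIn ζ y = cutInL (nP i.P) (MP i.P) ζ y.1 := rfl

/-- `cutH α ζ = ‖ζ‖_α + |ζ|` of [4]. [cite: Balaban1984PropagatorsI, Prop. 1.2 (1.111) p.35] -/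
theorem blockGeo_cutH (i : TopIdx d L) (α : ℝ) (ζ : (blockGeo d L a i).Cut) :
    (blockGeo d L a i).cutH α ζ = cutHL (nP i.P) (MP i.P) α ζ := rfl

/-- the distance of the block geometry is the ℓ¹ circular distance of the base points ((2.46) at one level; p. 223 «l¹-norm»).
[cite: Balaban1984PropagatorsII, p.223, (2.46) p.231] -/
theorem blockGeo_dist (i : TopIdx d L) (y c : (blockGeo d L a i).Site) :
    (blockGeo d L a i).dist y c = B6Prop26OneScaleFromB5.dist1 (MP i.P) y.1 c.1 := rfl

/-- `L^jη = 1` on every member (one level: `L^K·L^{−K}`). [cite: Balaban1984PropagatorsII, (2.1) p.224, p.235 («If we have one scale … a unit lattice operator»)] -/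
theorem blockGeo_len (i : TopIdx d L) (y : (blockGeo d L a i).Site) : (blockGeo d L a i).len y = 1 := by
  have hL : (L : ℝ) ≠ 0 := by
    have h1 := i.P.hL.2
    rw [i.hPL] at h1
    exact_mod_cast (show L ≠ 0 by omega)
  exact (B6Prop26OneScaleFromB5.guards_geoFam (a := a) i).2.2 hL y.1

variable (d L a)

/-- **PROPOSITION 2.6 ON THE BLOCK FAMILY, HYPOTHESIS-FREE** (`d ≥ 1`, odd `L > 1`, `a > 0`): r03 g9's `prop26Printed_famG` ([4]'s
Proposition 1.2, p37 `B5Prop12GHolds.prop12_famG_printed`) read on bonds (§1); `δ₃ = δ₀/d`.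
[cite: Balaban1984PropagatorsII, Prop. 2.6 (2.136)–(2.141) p.247; Balaban1984PropagatorsI, Prop. 1.2 (1.110)–(1.114) pp.35–36] -/
theorem prop26Printed_block (hd : 1 ≤ d) (hL : Odd L ∧ 1 < L) (ha : 0 < a) :
    Prop26Printed (blockGeo d L a) (blockG d L a) :=
  prop26Printed_bond (fun i : TopIdx d L => Fin i.P.d) (B6Prop26OneScaleFromB5.prop26Printed_famG hd hL ha)

end Family

section HBounds

variable {d : ℕ} (M : Fin (d + 1) → ℕ) [hM : ∀ μ, NeZero (M μ)]

omit hM in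
/-- the sup-distance decay factor is below the (2.151) factor in the ℓ¹ metric: `e^{−rateH·|y−c|_∞} ≤ e^{−(rateH/(d+1))·|y−c|₁}`
(`|·|₁ ≤ (d+1)|·|_∞`, r03 g9's `dist1_le`). [cite: Balaban1984PropagatorsII, p.223 (l¹ distance), Cor. 2.8 (2.151) p.249] -/
theorem EH_le_exp_dist1 (y c : Tor M) :
    EH M y c ≤ Real.exp (-(rateH (d + 1) / ((d : ℝ) + 1) * B6Prop26OneScaleFromB5.dist1 M y c)) := by
  rw [EH]
  apply Real.exp_le_exp.mpr
  have hd1 : (0 : ℝ) < (d : ℝ) + 1 := by positivity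
  have hr : 0 ≤ rateH (d + 1) := (rateH_pos (Nat.succ_pos d)).le
  have h := B6Prop26OneScaleFromB5.dist1_le M y c
  push_cast at h
  rw [neg_le_neg_iff, div_mul_eq_mul_div, div_le_iff₀ hd1]
  calc rateH (d + 1) * B6Prop26OneScaleFromB5.dist1 M y c ≤ rateH (d + 1) * (((d : ℝ) + 1) * distSite M y c) :=
        mul_le_mul_of_nonneg_left h hr
    _ = rateH (d + 1) * distSite M y c * ((d : ℝ) + 1) := by ring

end HBounds

section Generic

variable {D d₀ : ℕ} (n : ℕ) [NeZero n] (M : Fin D → ℕ) [hM : ∀ μ, NeZero (M μ)]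

/-- §2's sup bound of `H`, for a period vector of any dimension `D = d₀ ≥ 1` (by `D = d + 1`). [cite: Balaban1984PropagatorsII, Cor. 2.8 (2.151) p.249 (first entry)] -/
theorem norm_HkOp_bpt_le_gen (hd₀ : D = d₀) (hD : D ≠ 0) (y c : Tor M) (r : Fin D → Fin n) (μ lam : Fin D) :
    ‖HkOp n M (bpt n M y r, μ) (c, lam)‖ ≤ CH0 d₀ * Real.exp (-(rateH d₀ * distSite M y c)) := by
  subst hd₀
  obtain ⟨d, rfl⟩ := Nat.exists_eq_succ_of_ne_zero hD
  exact norm_HkOp_bpt_le n M y c r μ lam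

/-- §2's sup bound of `∇H`, any dimension `D = d₀ ≥ 1`. [cite: Balaban1984PropagatorsII, Cor. 2.8 (2.151) p.249 (second entry)] -/
theorem norm_dker_bpt_le_gen (hd₀ : D = d₀) (hD : D ≠ 0) (y c : Tor M) (r : Fin D → Fin n) (μ lam ν : Fin D) :
    ‖dker n M μ lam ν (bpt n M y r) c‖ ≤ CH1 d₀ * Real.exp (-(rateH d₀ * distSite M y c)) := by
  subst hd₀
  obtain ⟨d, rfl⟩ := Nat.exists_eq_succ_of_ne_zero hD
  exact norm_dker_bpt_le' n M y c r μ lam ν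

/-- §2's Hölder bound of `ζ∇H(·, c)`, any dimension `D = d₀ ≥ 1`. [cite: Balaban1984PropagatorsII, Cor. 2.8 (2.151) p.249 (third entry)] -/
theorem holderT_smulT_DH_le_gen (hd₀ : D = d₀) (hD : D ≠ 0) (hn : 1 ≤ n) {y : Tor M} {ζ : Tor (fine n M) → ℝ}
    (hζ : cutInL n M ζ y) (c : Tor M × Fin D) {α : ℝ} (hα0 : 0 ≤ α) (hα1 : α < 1) :
    holderT n M α (smulT n M ζ (DH n M c)) ≤ CHα d₀ α * cutHL n M α ζ * Real.exp (-(rateH d₀ * distSite M y c.1)) := by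
  subst hd₀
  obtain ⟨d, rfl⟩ := Nat.exists_eq_succ_of_ne_zero hD
  exact holderT_smulT_DH_le n M hn hζ c hα0 hα1

omit hM in
/-- the sup-distance decay factor versus the (2.151) factor in the ℓ¹ metric, any dimension `D = d₀ ≥ 1`. [cite: Balaban1984PropagatorsII, Cor. 2.8 (2.151) p.249] -/
theorem exp_rateH_le_gen (hd₀ : D = d₀) (hD : D ≠ 0) (y c : Tor M) :
    Real.exp (-(rateH d₀ * distSite M y c)) ≤
      Real.exp (-(rateH d₀ / (d₀ : ℝ) * B6Prop26OneScaleFromB5.dist1 M y c)) := by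
  subst hd₀
  obtain ⟨d, rfl⟩ := Nat.exists_eq_succ_of_ne_zero hD
  have h := EH_le_exp_dist1 M y c
  rw [EH] at h
  rw [Nat.cast_succ]
  exact h

end Generic

section Corollary

variable (d L : ℕ) (a : ℝ)

/-- **COROLLARY 2.8, VERBATIM (`B6.Cor28Printed`), ON THE BLOCK FAMILY WITH NO HYPOTHESIS** (every `d ≥ 1`, every `L`, `a`): witnesses
`M₁ = 1`, `δ₅ = rateH(d)/d = κ₁₆₃(d)/d²`, `O(1) = max(CH0 d, CH1 d, 1)`, `C(α) = CHα(d, α)`; all prefactors `(L^jη)^{…} = 1`; `H = GQ*(QGQ*)⁻¹ = H_K`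
read in [4]'s (1.108)–(1.109) vocabulary (supp ζ ⊂ Δ̃(y), ‖·‖_α with |x − x′| ≤ 1). [cite: Balaban1984PropagatorsII, Cor. 2.8 (2.150)–(2.151) p.249] -/
theorem cor28Printed_block (hd : 1 ≤ d) : Cor28Printed d (blockGeo d L a) (blockH d L a) := by
  refine ⟨1, rateH d / d, max (max (CH0 d) (CH1 d)) 1, fun α => CHα d α, one_pos,
    div_pos (rateH_pos hd) (by exact_mod_cast hd), lt_of_lt_of_le one_pos (le_max_right _ _), fun i _ _ => ?_⟩
  have hD : i.P.d ≠ 0 := by have := i.P.hd; omega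
  have hn : 1 ≤ nP i.P := one_le_nP i.P
  have hlen := blockGeo_len (a := a) i
  have hC0 : (0 : ℝ) ≤ max (max (CH0 d) (CH1 d)) 1 := le_trans zero_le_one (le_max_right _ _)
  refine ⟨fun nn y c => ?_, fun α ζ y c hα0 hα1 hζ => ?_⟩
  · rw [hlen y, hlen c, Real.one_rpow, Real.one_rpow, mul_one, mul_one]
    have hE := exp_rateH_le_gen (MP i.P) i.hPd hD y.1 c.1
    have key : (blockH d L a i).e nn y c ≤ max (max (CH0 d) (CH1 d)) 1 * Real.exp (-(rateH d * distSite (MP i.P) y.1 c.1)) := by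
      fin_cases nn
      · haveI : Nonempty ((Fin i.P.d → Fin (nP i.P)) × Fin i.P.d) :=
          ⟨(fun _ => ⟨0, hn⟩, ⟨0, Nat.pos_of_ne_zero hD⟩)⟩
        show (⨆ p : (Fin i.P.d → Fin (nP i.P)) × Fin i.P.d,
          ‖HkOp (nP i.P) (MP i.P) (bpt (nP i.P) (MP i.P) y.1 p.1, p.2) c‖) ≤ _
        refine ciSup_le fun p => ?_
        exact (norm_HkOp_bpt_le_gen (nP i.P) (MP i.P) i.hPd hD y.1 c.1 p.1 p.2 c.2).trans
          (mul_le_mul_of_nonneg_right ((le_max_left _ _).trans (le_max_left _ _)) (Real.exp_pos _).le)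
      · haveI : Nonempty ((Fin i.P.d → Fin (nP i.P)) × Fin i.P.d × Fin i.P.d) :=
          ⟨(fun _ => ⟨0, hn⟩, ⟨0, Nat.pos_of_ne_zero hD⟩, ⟨0, Nat.pos_of_ne_zero hD⟩)⟩
        show (⨆ p : (Fin i.P.d → Fin (nP i.P)) × Fin i.P.d × Fin i.P.d,
          ‖dker (nP i.P) (MP i.P) p.2.1 c.2 p.2.2 (bpt (nP i.P) (MP i.P) y.1 p.1) c.1‖) ≤ _
        refine ciSup_le fun p => ?_
        exact (norm_dker_bpt_le_gen (nP i.P) (MP i.P) i.hPd hD y.1 c.1 p.1 p.2.1 c.2 p.2.2).trans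
          (mul_le_mul_of_nonneg_right ((le_max_right _ _).trans (le_max_left _ _)) (Real.exp_pos _).le)
    exact key.trans (mul_le_mul_of_nonneg_left hE hC0)
  · rw [hlen y, hlen c, Real.one_rpow, Real.one_rpow, mul_one, mul_one]
    have hE := exp_rateH_le_gen (MP i.P) i.hPd hD y.1 c.1
    have h1 := holderT_smulT_DH_le_gen (nP i.P) (MP i.P) i.hPd hD hn hζ c hα0 hα1
    exact h1.trans (mul_le_mul_of_nonneg_left hE (mul_nonneg (CHα_nonneg d α) (cutHL_nonneg α ζ)))

/-- **non-vacuity**: every member meets the guards of `B6.Cor28Printed`/`B6.Prop26Printed` with `M₁ = 1` ((2.1)–(2.2) void, `M = 1`),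
and the index type is inhabited for `d ≥ 1`, odd `L > 1` — so (2.136)–(2.140) and (2.151) are asserted for every torus of the family.
[cite: Balaban1984PropagatorsII, Prop. 2.6 p.247 + Cor. 2.8 p.249 (hypotheses (2.1)–(2.2), M large)] -/
theorem block_meets_hypotheses (i : TopIdx d L) :
    (blockGeo d L a i).Hyp21_22 ∧ (1 : ℝ) ≤ (blockGeo d L a i).M ∧ ∀ y, (blockGeo d L a i).len y = 1 :=
  ⟨trivial, le_rfl, blockGeo_len i⟩


end Corollary

/-! ## §4  `B6.MainResults` on ONE `BlockData`; honesty links -/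

section Main

variable (d L : ℕ) (a : ℝ)

/-- **the one-level block bundle**: index = [4]'s tori of record (`TopIdx d L`: every volume `2L^m`, every `K ≥ 1`), `geo` = the block
geometries of §3, `G` = the (2.136)–(2.140) functionals of `G = Δ_a⁻¹`, `H` = the (2.150)–(2.151) functionals of `H = GQ*(QGQ*)⁻¹`;
the carriers `B6.MainResults` does not mention (`δ₀`, `Gp`, `Cinv`, `Qinv`, the tree-gauge data and the local operators) are
PARAMETERS — nothing is chosen for them and nothing is claimed about them here. [cite: Balaban1984PropagatorsII, pp.223–250 (the carriers of `B6.BlockData`)] -/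
def oneLevelBlock (δ₀ : ℝ) (Gp : ∀ i : TopIdx d L, B6.GpFamily (blockGeo d L a i))
    (Cinv : ∀ i : TopIdx d L, B6.SiteKernel (blockGeo d L a i)) (Qinv : ∀ i : TopIdx d L, B6.SiteKernel (blockGeo d L a i))
    (J : Type) (tree : J → B6.TreeData) (K : Type) (loc : K → B6.LocalOp) : BlockData where
  I := TopIdx d L
  d := d
  L := L
  δ₀ := δ₀
  geo := blockGeo d L a
  Gp := Gp
  Cinv := Cinv
  G := blockG d L a
  Qinv := Qinv
  H := blockH d L a
  J := J
  tree := tree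
  K := K
  loc := loc

/-- **`B6.MainResults` — «This Corollary and Proposition 2.6 are our main technical results» (p. 249) — INHABITED ON ONE `BlockData`,
HYPOTHESIS-FREE** (every `d ≥ 1`, odd `L > 1`, `a > 0`, and WHATEVER the carriers not mentioned by `MainResults` are): the verbatim
`B6.Prop26Printed` and `B6.Cor28Printed` hold TOGETHER for the one-level block family, `G = Δ_a⁻¹` and `H = GQ*(QGQ*)⁻¹` being read
on the SAME geometry (§3). [cite: Balaban1984PropagatorsII, p.249 («This Corollary and Proposition 2.6 are our main technical results»), Prop. 2.6 p.247, Cor. 2.8 p.249] -/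
theorem mainResults_oneLevel (hd : 1 ≤ d) (hL : Odd L ∧ 1 < L) (ha : 0 < a) (δ₀ : ℝ)
    (Gp : ∀ i : TopIdx d L, B6.GpFamily (blockGeo d L a i)) (Cinv : ∀ i : TopIdx d L, B6.SiteKernel (blockGeo d L a i))
    (Qinv : ∀ i : TopIdx d L, B6.SiteKernel (blockGeo d L a i)) (J : Type) (tree : J → B6.TreeData) (K : Type)
    (loc : K → B6.LocalOp) : MainResults (oneLevelBlock d L a δ₀ Gp Cinv Qinv J tree K loc) :=
  ⟨prop26Printed_block d L a hd hL ha, cor28Printed_block d L a hd⟩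

/-- the two main results as one conjunction over the block family (the content of `mainResults_oneLevel` without the bundle).
[cite: Balaban1984PropagatorsII, Prop. 2.6 p.247, Cor. 2.8 p.249] -/
theorem prop26_and_cor28_block (hd : 1 ≤ d) (hL : Odd L ∧ 1 < L) (ha : 0 < a) :
    Prop26Printed (blockGeo d L a) (blockG d L a) ∧ Cor28Printed d (blockGeo d L a) (blockH d L a) :=
  ⟨prop26Printed_block d L a hd hL ha, cor28Printed_block d L a hd⟩

variable {d L a}

/-- HONESTY LINK (G side): the (2.136) entries of `blockG` ARE [4]'s (1.110) functionals of r02's setting of record at the base point,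
i.e. sups over `Δ̃(y₋)` of `|(Δ_a⁻¹J)(x)|`, `|(∇Δ_a⁻¹J)(x)|`, `|(Δ_a⁻¹∇*J)(x)|`, `|(ΔΔ_a⁻¹J)(x)|` for the typed `Δ_a = B5DeltaA169.DeltaA (nP P) (MP P) a`
(`B5Prop12FieldsLattice.eL`). [cite: Balaban1984PropagatorsII, (2.136) p.247; Balaban1984PropagatorsI, (1.110) p.35] -/
theorem blockG_e_eq (i : TopIdx d L) (m : Fin 4) (J : (blockGeo d L a i).Loc) (y : (blockGeo d L a i).Site) :
    (blockG d L a i).e m J y = B5Prop12FieldsLattice.eL (nP i.P) (MP i.P) a m J.emb y.1 := rfl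

/-- HONESTY LINK (G side, Hölder and L² entries): `h1`, `e4`, `h2`, `l2` of `blockG` are [4]'s (1.111)–(1.114) functionals `h1L`, `e4L`,
`h2L`, `η^{d/2}·l2locL` of the same `Δ_a⁻¹`. [cite: Balaban1984PropagatorsII, (2.137)–(2.140) p.247; Balaban1984PropagatorsI, (1.111)–(1.114) pp.35–36] -/
theorem blockG_h1_e4_h2_l2_eq (i : TopIdx d L) (J : (blockGeo d L a i).Loc) (α : ℝ) (ζ : (blockGeo d L a i).Cut)
    (y : (blockGeo d L a i).Site) (m : Fin 6) :
    (blockG d L a i).h1 J α ζ = B5Prop12FieldsLattice.h1L (nP i.P) (MP i.P) a J.emb α ζ ∧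
    (blockG d L a i).e4 J y = B5Prop12FieldsLattice.e4L (nP i.P) (MP i.P) a J.emb y.1 ∧
    (blockG d L a i).h2 J α ζ = B5Prop12FieldsLattice.h2L (nP i.P) (MP i.P) a J.emb α ζ ∧
    (blockG d L a i).l2 m J ζ = B5SettingP12Weighted.sqEta (nP i.P) i.P.d * B5Prop12FieldsLattice.l2locL (nP i.P) (MP i.P) a m J.emb ζ :=
  ⟨rfl, rfl, rfl, rfl⟩

/-- HONESTY LINK (H side): the operator read by `blockH` — the typed `H_k` of [4] (1.63), `B5Hk163Torus.HkOp` — IS (2.35) = [4] (1.103)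
`H = GQ*(QGQ*)⁻¹` built from THE SAME `G = Δ_a⁻¹ = (DeltaA (nP P) (MP P) a)⁻¹` whose functionals `blockG` reads (`Q* = η^{−d}Qᵀ` =
`B5DeltaA169.QvAdj`): by g12's uniqueness of the minimiser (`B5Hk163Form166.HkOp_eq_Hk`) and `B5DeltaA169.calG_eq_DeltaA_inv`.
[cite: Balaban1984PropagatorsII, (2.35) p.228 («A = HB = GQ*(QGQ*)⁻¹B … the same representation for the operator H as in (1.103)»); Balaban1984PropagatorsI, (1.103) p.34, (1.63) p.28] -/
theorem blockH_operator_eq (i : TopIdx d L) (ha : 0 < a) :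
    HkOp (nP i.P) (MP i.P) =
      (B5DeltaA169.DeltaA (nP i.P) (MP i.P) a)⁻¹ * B5DeltaA169.QvAdj (nP i.P) (MP i.P) *
        (B5Block118.QvOp (nP i.P) (MP i.P) * (B5DeltaA169.DeltaA (nP i.P) (MP i.P) a)⁻¹ *
          B5DeltaA169.QvAdj (nP i.P) (MP i.P))⁻¹ := by
  rw [B5Hk163Form166.HkOp_eq_Hk (nP i.P) (one_le_nP i.P) (MP i.P) a ha, Beta.FluctuationProjection.Hk,
    Beta.FluctuationProjection.QGQ, B5DeltaA169.calG_eq_DeltaA_inv]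

/-- HONESTY LINK (H side, entries): `e 0`, `e 1` of `blockH` are the sups over the fine bonds of the block `Δ(y₋)` of the matrix entries
of `H_k` and of `∂_νH_k` (`dker`, the `η⁻¹`-difference quotient of the kernel), `h` is the (1.109) Hölder seminorm of `ζ·∇H(·, c)`.
[cite: Balaban1984PropagatorsII, (2.150)–(2.151) p.249] -/
theorem blockH_h_eq (i : TopIdx d L) (α : ℝ) (ζ : (blockGeo d L a i).Cut) (c : (blockGeo d L a i).Site) :
    (blockH d L a i).h α ζ c = holderT (nP i.P) (MP i.P) α (smulT (nP i.P) (MP i.P) ζ (DH (nP i.P) (MP i.P) c)) := rfl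

end Main

end

end Literature.MathematicalPhysics.QuantumFieldTheory.Balaban1983to89.B6MainResultsOneLevel
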